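import Mathlib.Probability.ProbabilityMassFunction.Integrals
import Mathlib.MeasureTheory.Function.L2Space
import HarnessLib

/-!
# Lower integrals under `PMF.toMeasure`, compound laws, and square-integrability of mixtures

Topic `Probability/Distributions`; theorems only. On a countable measurable space with measurable
singletons (e.g. a lattice), the measure of a `PMF` is a weighted sum of Dirac masses, so lower
integrals are `tsum`s; under a compound law `p ≫= κ` they are the `p`-weighted sums of the
component integrals. Consequence used by the `PMF`-level analysis of Micciancio–Regev 2007,
Thm. 5.23 (the witness law `D` is a mixture over the conditions `(C, A, z)`; the verifier estimate
needs `w ∈ L²(D)`): a mixture whose components have uniformly bounded second moments is square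
integrable.

* `PMF.lintegral_toMeasure_eq_tsum` — `∫⁻ f ∂q = ∑' x, q x · f x`;
* `PMF.lintegral_toMeasure_bind` — `∫⁻ f ∂(p ≫= κ) = ∑' a, p a · ∫⁻ f ∂(κ a)`;
* `PMF.lintegral_toMeasure_map` — `∫⁻ f ∂(p.map g) = ∑' a, p a · f (g a)`;
* `PMF.lintegral_toMeasure_bind_le_of_forall` — if `∫⁻ f ∂(κ a) ≤ C` on `supp p` then
  `∫⁻ f ∂(p ≫= κ) ≤ C`;
* `PMF.memLp_two_toMeasure_of_lintegral_sq_le` — `F ∈ L²(q)` whenever `∫⁻ ‖F‖ₑ² ∂q ≤ C < ∞`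
  (with the bind/map forms above this bounds mixtures).

## References

* W. Feller, *An Introduction to Probability Theory and Its Applications I*, 3rd ed., Wiley 1968,
  Ch. IX §2 (expectations of discrete variables; conditional expectations) [folklore].
-/

noncomputable section

open MeasureTheory
open scoped ENNReal

namespace PMF

variable {α β : Type*} [MeasurableSpace β] [MeasurableSingletonClass β] [Countable β]

/-- **Lower integrals under a `PMF` are weighted sums**: `∫⁻ f ∂q = ∑' x, q x · f x`. [folklore] -/
theorem lintegral_toMeasure_eq_tsum (q : PMF β) (f : β → ℝ≥0∞) :
    ∫⁻ x, f x ∂q.toMeasure = ∑' x, q x * f x := by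
  rw [MeasureTheory.lintegral_countable']
  refine tsum_congr fun x => ?_
  rw [PMF.toMeasure_apply_singleton _ _ (measurableSet_singleton x), mul_comm]

/-- **Lower integrals under a compound law**: `∫⁻ f ∂(p ≫= κ) = ∑' a, p a · ∫⁻ f ∂(κ a)`. [folklore] -/
theorem lintegral_toMeasure_bind (p : PMF α) (κ : α → PMF β) (f : β → ℝ≥0∞) :
    ∫⁻ x, f x ∂(p.bind κ).toMeasure = ∑' a, p a * ∫⁻ x, f x ∂(κ a).toMeasure := by
  simp_rw [lintegral_toMeasure_eq_tsum, PMF.bind_apply]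
  calc ∑' x, (∑' a, p a * (κ a) x) * f x = ∑' x, ∑' a, p a * ((κ a) x * f x) := by
        refine tsum_congr fun x => ?_
        rw [← ENNReal.tsum_mul_right]
        exact tsum_congr fun a => mul_assoc _ _ _
    _ = ∑' a, ∑' x, p a * ((κ a) x * f x) := ENNReal.tsum_comm
    _ = ∑' a, p a * ∑' x, (κ a) x * f x := tsum_congr fun a => ENNReal.tsum_mul_left

/-- **Lower integrals under a push-forward**: `∫⁻ f ∂(p.map g) = ∑' a, p a · f (g a)`. [folklore] -/
theorem lintegral_toMeasure_map (p : PMF α) (g : α → β) (f : β → ℝ≥0∞) :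
    ∫⁻ x, f x ∂(p.map g).toMeasure = ∑' a, p a * f (g a) := by
  classical
  rw [← PMF.bind_pure_comp, lintegral_toMeasure_bind]
  refine tsum_congr fun a => ?_
  congr 1
  rw [Function.comp_apply, lintegral_toMeasure_eq_tsum, tsum_eq_single (g a)]
  · rw [PMF.pure_apply, if_pos rfl, one_mul]
  · intro x hx
    rw [PMF.pure_apply, if_neg hx, zero_mul]

/-- **A mixture is bounded by its worst component on the support** (lower integrals). [folklore] -/
theorem lintegral_toMeasure_bind_le_of_forall (p : PMF α) (κ : α → PMF β) (f : β → ℝ≥0∞) {C : ℝ≥0∞}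
    (h : ∀ a ∈ p.support, ∫⁻ x, f x ∂(κ a).toMeasure ≤ C) :
    ∫⁻ x, f x ∂(p.bind κ).toMeasure ≤ C := by
  rw [lintegral_toMeasure_bind]
  calc ∑' a, p a * ∫⁻ x, f x ∂(κ a).toMeasure ≤ ∑' a, p a * C := by
        refine ENNReal.tsum_le_tsum fun a => ?_
        by_cases ha : a ∈ p.support
        · exact mul_le_mul' le_rfl (h a ha)
        · rw [(PMF.apply_eq_zero_iff p a).2 ha, zero_mul, zero_mul]
    _ = C := by rw [ENNReal.tsum_mul_right, PMF.tsum_coe, one_mul]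

omit [Countable β] [MeasurableSingletonClass β] in
/-- **Square-integrability from a bound on the second moment**: if `∫⁻ ‖F‖ₑ² ∂q ≤ C < ∞` then
`F ∈ L²(q)` (measurability is automatic on a countable space with measurable singletons when `β` is
countable; here it is assumed through `AEStronglyMeasurable`). [folklore] -/
theorem memLp_two_toMeasure_of_lintegral_sq_le {E : Type*} [NormedAddCommGroup E] (q : PMF β)
    {F : β → E} (hF : AEStronglyMeasurable F q.toMeasure) {C : ℝ≥0∞} (hC : C ≠ ∞)
    (h : ∫⁻ x, ‖F x‖ₑ ^ 2 ∂q.toMeasure ≤ C) : MemLp F 2 q.toMeasure := by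
  refine ⟨hF, ?_⟩
  rw [eLpNorm_eq_lintegral_rpow_enorm_toReal two_ne_zero ENNReal.ofNat_ne_top]
  have h2 : (2 : ℝ≥0∞).toReal = 2 := by norm_num
  rw [h2]
  refine ENNReal.rpow_lt_top_of_nonneg (by norm_num) ?_
  have hlt : ∫⁻ x, ‖F x‖ₑ ^ (2 : ℝ) ∂q.toMeasure < ∞ := by
    have heq : ∫⁻ x, ‖F x‖ₑ ^ (2 : ℝ) ∂q.toMeasure = ∫⁻ x, ‖F x‖ₑ ^ 2 ∂q.toMeasure :=
      lintegral_congr fun x => by rw [← ENNReal.rpow_natCast]; norm_num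
    rw [heq]
    exact lt_of_le_of_lt h (lt_top_iff_ne_top.2 hC)
  exact hlt.ne

end PMF

end
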